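import Mathlib
import HarnessLib
import Summits.AtomisticToContinuum.BoseEinsteinCondensation.Theses.BECThomsonPrinciple

/-!
Sketch for crux-ideate stmt-AtomisticToContinuum-9479 (GaussianDominationCan), ideator 2, round 1.
First lemmas of the idea cards; they need not be proved, they must elaborate.
-/

noncomputable section

namespace Summit.AtomisticToContinuum.BoseEinsteinCondensation.Cruxes.GaussianDominationCan.Sketch

open MeasureTheory
open scoped ENNReal ComplexConjugate
open Literature.MathematicalPhysics.QuantumManyBody.BoseGas

/-- The chord body of `GaussianDominationCan` for a given potential `w`, constant `C`,
particle number `m+1`, side `L` and lattice momentum `n` (all `s ≥ 0`, all trial states). -/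
def GDChordBody (w : ℝ → ℝ≥0∞) (C : ℝ) (m : ℕ) (L : ℝ) (n : Fin 3 → ℤ) : Prop :=
  ∀ s : ℝ, 0 ≤ s → ∀ Φ : PeriodicTrialState (m + 1) L,
    let P : Fin (m + 1) → (Config (m + 1) → ℂ) → (Config (m + 1) → ℂ) :=
      fun i g X => ((L ^ 3)⁻¹ : ℝ) • ∫ y in cell L, g (Function.update X i y)
    let Q : Finset (Fin (m + 1)) → (Config (m + 1) → ℂ) → (Config (m + 1) → ℂ) :=
      fun S g => (List.finRange (m + 1)).foldr (fun i h => if i ∈ S then P i h else h - P i h) g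
    let Θ : Config (m + 1) → ℂ := fun X =>
      ∑ S ∈ (Finset.univ : Finset (Finset (Fin (m + 1)))).filter (fun S => (0 : Fin (m + 1)) ∈ S),
        ((Real.sqrt (S.card : ℝ))⁻¹ : ℂ) * Q S Φ.ψ X
    periodicGroundStateEnergy w (m + 1) L +
        ENNReal.ofReal (s * (2 * (m + 1) * ‖∫ X in cellN (m + 1) L,
          (starRingEnd ℂ) (Φ.ψ X) *
            Complex.exp (Complex.I * ↑(2 * Real.pi / L * ∑ j, (n j : ℝ) * X 0 j)) * Θ X‖)) ≤
      periodicEnergy w Φ + ENNReal.ofReal (C * s ^ 2 * L ^ 2 / ‖(fun j => (n j : ℝ))‖ ^ 2)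

/-- Sanity: the route crux is the windowed `∃ ρ₀ C N₀` closure of `GDChordBody`. -/
example : Theses.BECThomsonPrinciple.GaussianDominationCan ↔
    (∀ v : ℝ → ℝ≥0∞, IsRepulsiveFiniteRange v → ∀ M : ℝ, 0 < M → ∃ ρ₀ C : ℝ, 0 < ρ₀ ∧ 0 < C ∧
      ∃ N₀ : ℕ, ∀ m : ℕ, N₀ ≤ m + 1 → ∀ L : ℝ, 0 < L → ((m + 1 : ℕ) : ℝ) ≤ ρ₀ * L ^ 3 →
      ∀ n : Fin 3 → ℤ, n ≠ 0 →
        2 * Real.pi * ‖(fun j => (n j : ℝ))‖ / L ≤ M * Real.sqrt ((m + 1 : ℕ) / L ^ 3) →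
        GDChordBody v C m L n) :=
  Iff.rfl

/-! ### Card `gauge-split-backflow`: first lemma `GaugeChord` -/

/-- **GaugeChord** (pure-gauge Gaussian domination, exact; provable now). Conjugating by the
unitary `e^{i s F}`, `F(X) = ∑ᵢ f(xᵢ)` with `f` real, `C¹`, `L`-periodic, `|∂ₗ f| ≤ B`, maps
periodic trial states to periodic trial states and
`E(e^{isF}Φ) = E(Φ) + s·J_f(Φ) + s² ∫ ∑ᵢ |∇f(xᵢ)|²|Φ|²`, where
`J_f(Φ) = 2 ∑ᵢ ∑ₗ ∫ ∂ₗf(xᵢ) · Im(conj(Φ) ∂_{i,l}Φ)` is the expectation of the longitudinal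
current coupled to `∇f`. Hence the chord inequality
`E₀^per + s|J_f(Φ)| ≤ E(Φ) + 3 s² N B²` for every `s ≥ 0`: Gaussian domination with the
diamagnetic constant for every CURRENT source, for every `v ≥ 0` (hard cores included),
every `N`, `L`. [folklore: continuity equation / f-sum rule; Simon 1976 diamagnetism] -/
def GaugeChord : Prop :=
  ∀ v : ℝ → ℝ≥0∞, IsRepulsiveFiniteRange v → ∀ m : ℕ, ∀ L : ℝ, 0 < L →
    ∀ f : Space → ℝ, ContDiff ℝ 1 f →
      (∀ (x : Space) (l : Fin 3), f (x + EuclideanSpace.single l L) = f x) →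
      ∀ B : ℝ, (∀ (x : Space) (l : Fin 3), |fderiv ℝ f x (EuclideanSpace.single l (1 : ℝ))| ≤ B) →
      ∀ Φ : PeriodicTrialState (m + 1) L, ∀ s : ℝ, 0 ≤ s →
        periodicGroundStateEnergy v (m + 1) L +
            ENNReal.ofReal (s * |2 * ∑ i : Fin (m + 1), ∑ l : Fin 3,
              ∫ X in cellN (m + 1) L,
                fderiv ℝ f (X i) (EuclideanSpace.single l (1 : ℝ)) *
                  ((starRingEnd ℂ) (Φ.ψ X) *
                    fderiv ℝ Φ.ψ X (Pi.single i (EuclideanSpace.single l (1 : ℝ)))).im|) ≤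
          periodicEnergy v Φ + ENNReal.ofReal (s ^ 2 * (3 * (m + 1) * B ^ 2))

/-- **ChordSplit** (concavity of the sourced infimum; provable now, pure order theory):
if two real source functionals `a`, `b` on trial states each satisfy a chord inequality with
constants `Ca`, `Cb`, then `a + b` satisfies it with constant `2 (Ca + Cb)`. This is the
`inf (F + G) ≥ inf F + inf G` step that lets `GaussianDominationCan`'s source be split into a
pure-gauge part, a backflow part and a density part. -/
def ChordSplit : Prop :=
  ∀ (ι : Type) (E : ι → ℝ≥0∞) (E₀ : ℝ≥0∞) (a b : ι → ℝ) (Ca Cb : ℝ), 0 ≤ Ca → 0 ≤ Cb →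
    (∀ s : ℝ, 0 ≤ s → ∀ Φ, E₀ + ENNReal.ofReal (s * |a Φ|) ≤ E Φ + ENNReal.ofReal (Ca * s ^ 2)) →
    (∀ s : ℝ, 0 ≤ s → ∀ Φ, E₀ + ENNReal.ofReal (s * |b Φ|) ≤ E Φ + ENNReal.ofReal (Cb * s ^ 2)) →
    ∀ s : ℝ, 0 ≤ s → ∀ Φ,
      E₀ + ENNReal.ofReal (s * |a Φ + b Φ|) ≤ E Φ + ENNReal.ofReal (2 * (Ca + Cb) * s ^ 2)

/-! ### Card `coupling-monotone-chord`: first lemma `FreeGDChord`, crux `CouplingMonotoneChord` -/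

/-- **FreeGDChord** (the anchor; provable now): for the free gas `v = 0` the chord body of
`GaussianDominationCan` holds with the sharp constant `C = 1/(4π²)` (i.e. `1/k²` for
`k = 2π|n|/L`, up to the sup-norm typing of `‖n‖`), for every `N ≥ 1`, `L > 0`, `n ≠ 0`,
with no density window: `T ≥ k² Λ_k†Λ_k = k² n_k` and
`k²Λ†Λ − s(Λ + Λ†) = k²(Λ − s/k²)†(Λ − s/k²) − s²/k² ≥ −s²/k²` (refuter notes on item 9479). -/
def FreeGDChord : Prop :=
  ∀ m : ℕ, ∀ L : ℝ, 0 < L → ∀ n : Fin 3 → ℤ, n ≠ 0 →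
    GDChordBody 0 (1 / (4 * Real.pi ^ 2)) m L n

/-- **CouplingMonotoneChord** (crux of card `coupling-monotone-chord`): along the linear
interpolation `t ↦ t·v` of a bounded repulsive finite-range potential, inside the density
window of `GaussianDominationCan`, the chord body with a given constant `C` is inherited
upwards in the coupling: repulsion never raises the static susceptibility of the LNSS source
(Ginibre-type monotonicity; by Hellmann–Feynman, `dχ/dt = −∂²_s ⟨V⟩`, it is the
source-convexity of the interaction energy). With `t₁ = 0` and `FreeGDChord` it yields the
crux for bounded `v` with `C = 1/(4π²)`; hard cores by monotone truncation. -/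
def CouplingMonotoneChord : Prop :=
  ∀ v : ℝ → ℝ≥0∞, IsRepulsiveFiniteRange v → (∃ B : ℝ, ∀ r, v r ≤ ENNReal.ofReal B) →
    ∀ M : ℝ, 0 < M → ∃ ρ₀ : ℝ, 0 < ρ₀ ∧ ∃ N₀ : ℕ, ∀ m : ℕ, N₀ ≤ m + 1 →
      ∀ L : ℝ, 0 < L → ((m + 1 : ℕ) : ℝ) ≤ ρ₀ * L ^ 3 → ∀ n : Fin 3 → ℤ, n ≠ 0 →
        2 * Real.pi * ‖(fun j => (n j : ℝ))‖ / L ≤ M * Real.sqrt ((m + 1 : ℕ) / L ^ 3) →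
        ∀ t₁ t₂ : ℝ, 0 ≤ t₁ → t₁ ≤ t₂ → t₂ ≤ 1 → ∀ C : ℝ, 0 < C →
          GDChordBody (fun r => ENNReal.ofReal t₁ * v r) C m L n →
          GDChordBody (fun r => ENNReal.ofReal t₂ * v r) C m L n

/-- Glue check (pure logic, modulo `(fun r => ENNReal.ofReal 1 * v r) = v`): the anchor plus
the monotone transfer give the chord body at `t = 1` with `C = 1/(4π²)` for bounded `v`. -/
example (hF : FreeGDChord) (hM : CouplingMonotoneChord) :
    ∀ v : ℝ → ℝ≥0∞, IsRepulsiveFiniteRange v → (∃ B : ℝ, ∀ r, v r ≤ ENNReal.ofReal B) →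
    ∀ M : ℝ, 0 < M → ∃ ρ₀ : ℝ, 0 < ρ₀ ∧ ∃ N₀ : ℕ, ∀ m : ℕ, N₀ ≤ m + 1 →
      ∀ L : ℝ, 0 < L → ((m + 1 : ℕ) : ℝ) ≤ ρ₀ * L ^ 3 → ∀ n : Fin 3 → ℤ, n ≠ 0 →
        2 * Real.pi * ‖(fun j => (n j : ℝ))‖ / L ≤ M * Real.sqrt ((m + 1 : ℕ) / L ^ 3) →
        GDChordBody (fun r => ENNReal.ofReal 1 * v r) (1 / (4 * Real.pi ^ 2)) m L n := by
  intro v hv hB M hM0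
  obtain ⟨ρ₀, hρ₀, N₀, h⟩ := hM v hv hB M hM0
  refine ⟨ρ₀, hρ₀, N₀, fun m hm L hL hρ n hn hw => ?_⟩
  have h0 : GDChordBody (fun r => ENNReal.ofReal 0 * v r) (1 / (4 * Real.pi ^ 2)) m L n := by
    have : (fun r => ENNReal.ofReal 0 * v r) = (0 : ℝ → ℝ≥0∞) := by
      funext r; simp
    rw [this]; exact hF m L hL n hn
  exact h m hm L hL hρ n hn hw 0 1 le_rfl zero_le_one le_rfl _ (by positivity) h0

/-! ### Card `cage-opening-flows`: first lemma `AllCoordFibreFlow` -/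

/-- **AllCoordFibreFlow** (first lemma of card `cage-opening-flows`; the hard-core-capable cut of
`GaussianDominationCan`'s FibreStep). For an exact periodic minimiser `Φ` (zeros allowed: hard
cores), the fibre-neutral transverse charge of particle `0`,
`q(X) = e^{ik·x₀} (P₀Φ)(X) conj(Φ(X)) − (|Φ(X)|²/W(X̂)) ∫_cell e^{ik·y} (P₀Φ)(X) conj(Φ(y,X̂)) dy`
(`P₀Φ` = cell average of `Φ` in `x₀`, `W(X̂) = ∫_cell |Φ(y,X̂)|² dy`), is the weak divergence —
over ALL `3N` coordinates, not only the `x₀`-fibre — of a flow `J` vanishing on the zero set of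
`Φ`, with Thomson cost `∫ |J|²/|Φ|² ≤ C L²/‖n‖²` (free gas: `J = k̂ e^{ik·x₀}|Φ|²/(i|k|)`, cost
exactly `1/k²`). Weaker than `FibreConductance` for bounded `v` (more admissible flows), and the
only version that can hold for hard cores (cages have infinite fibre resistance; the flow must
exit through the wall particles' coordinates — Osada's mechanism). [GrimmettKestenZhang1993,
doi:10.1007/s004400050183, LSSY2005] -/
def AllCoordFibreFlow : Prop :=
  ∀ v : ℝ → ℝ≥0∞, IsRepulsiveFiniteRange v → ∀ M : ℝ, 0 < M → ∃ ρ₀ C : ℝ, 0 < ρ₀ ∧ 0 < C ∧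
    ∃ N₀ : ℕ, ∀ m : ℕ, N₀ ≤ m + 1 → ∀ L : ℝ, 0 < L → ((m + 1 : ℕ) : ℝ) ≤ ρ₀ * L ^ 3 →
    ∀ n : Fin 3 → ℤ, n ≠ 0 →
      2 * Real.pi * ‖(fun j => (n j : ℝ))‖ / L ≤ M * Real.sqrt ((m + 1 : ℕ) / L ^ 3) →
    ∀ Φ : PeriodicTrialState (m + 1) L,
      periodicEnergy v Φ = periodicGroundStateEnergy v (m + 1) L →
      let PΦ : Config (m + 1) → ℂ := fun X => ((L ^ 3)⁻¹ : ℝ) • ∫ y in cell L, Φ.ψ (Function.update X 0 y)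
      let W : Config (m + 1) → ℝ := fun X => ∫ y in cell L, ‖Φ.ψ (Function.update X 0 y)‖ ^ 2
      let e : Space → ℂ := fun x => Complex.exp (Complex.I * ↑(2 * Real.pi / L * ∑ j, (n j : ℝ) * x j))
      let q : Config (m + 1) → ℂ := fun X =>
        e (X 0) * PΦ X * (starRingEnd ℂ) (Φ.ψ X) -
          ((‖Φ.ψ X‖ ^ 2 / W X : ℝ) : ℂ) *
            ∫ y in cell L, e y * PΦ X * (starRingEnd ℂ) (Φ.ψ (Function.update X 0 y))
      ∃ J : Config (m + 1) → Fin (m + 1) → Fin 3 → ℂ,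
        (∀ X, Φ.ψ X = 0 → J X = 0) ∧
        (∀ η : Config (m + 1) → ℂ, ContDiff ℝ 1 η →
          (∀ X (i : Fin (m + 1)) (l : Fin 3), η (X + Pi.single i (EuclideanSpace.single l L)) = η X) →
          ∫ X in cellN (m + 1) L, ∑ i : Fin (m + 1), ∑ l : Fin 3,
              J X i l * fderiv ℝ η X (Pi.single i (EuclideanSpace.single l (1 : ℝ))) =
            - ∫ X in cellN (m + 1) L, q X * η X) ∧
        ∫⁻ X in cellN (m + 1) L,
            ENNReal.ofReal ((∑ i : Fin (m + 1), ∑ l : Fin 3, ‖J X i l‖ ^ 2) / ‖Φ.ψ X‖ ^ 2) ≤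
          ENNReal.ofReal (C * L ^ 2 / ‖(fun j => (n j : ℝ))‖ ^ 2)

/-! ### Card `raman-chord-regimes`: first lemmas `LargeSAnchor` (provable now) and `ChordAboveHealing` -/

/-- The chord body restricted to source strengths `s ≥ s₀`. -/
def GDChordFrom (w : ℝ → ℝ≥0∞) (C s₀ : ℝ) (m : ℕ) (L : ℝ) (n : Fin 3 → ℤ) : Prop :=
  ∀ s : ℝ, s₀ ≤ s → ∀ Φ : PeriodicTrialState (m + 1) L,
    let P : Fin (m + 1) → (Config (m + 1) → ℂ) → (Config (m + 1) → ℂ) :=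
      fun i g X => ((L ^ 3)⁻¹ : ℝ) • ∫ y in cell L, g (Function.update X i y)
    let Q : Finset (Fin (m + 1)) → (Config (m + 1) → ℂ) → (Config (m + 1) → ℂ) :=
      fun S g => (List.finRange (m + 1)).foldr (fun i h => if i ∈ S then P i h else h - P i h) g
    let Θ : Config (m + 1) → ℂ := fun X =>
      ∑ S ∈ (Finset.univ : Finset (Finset (Fin (m + 1)))).filter (fun S => (0 : Fin (m + 1)) ∈ S),
        ((Real.sqrt (S.card : ℝ))⁻¹ : ℂ) * Q S Φ.ψ X
    periodicGroundStateEnergy w (m + 1) L +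
        ENNReal.ofReal (s * (2 * (m + 1) * ‖∫ X in cellN (m + 1) L,
          (starRingEnd ℂ) (Φ.ψ X) *
            Complex.exp (Complex.I * ↑(2 * Real.pi / L * ∑ j, (n j : ℝ) * X 0 j)) * Θ X‖)) ≤
      periodicEnergy w Φ + ENNReal.ofReal (C * s ^ 2 * L ^ 2 / ‖(fun j => (n j : ℝ))‖ ^ 2)

/-- Bookkeeping (provable now): the full chord body is the `s₀ = 0` case. -/
example (w : ℝ → ℝ≥0∞) (C : ℝ) (m : ℕ) (L : ℝ) (n : Fin 3 → ℤ) :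
    GDChordBody w C m L n ↔ GDChordFrom w C 0 m L n := Iff.rfl

/-- **LargeSAnchor** (provable now from `FreeGDChord` and `V ≥ 0`): for every repulsive `v` the
chord holds with constant `C > 1/(4π²)` as soon as `(C − 1/(4π²)) s² L²/‖n‖² ≥ E₀^per(v)`,
because `T − s(Λ + Λ†) ≥ −s²/k²` and `periodicEnergy v Φ ≥ periodicEnergy 0 Φ`. With Dyson's
bound `E₀^per ≤ 4πaρN(1+o(1))` this is `s ≳ k √(ρ a N)`: the crux has content only below. -/
def LargeSAnchor : Prop :=
  ∀ v : ℝ → ℝ≥0∞, IsRepulsiveFiniteRange v → ∀ C : ℝ, 1 / (4 * Real.pi ^ 2) < C →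
    ∀ m : ℕ, ∀ L : ℝ, 0 < L → ∀ n : Fin 3 → ℤ, n ≠ 0 →
      periodicGroundStateEnergy v (m + 1) L ≠ ⊤ →
      GDChordFrom v C
        (Real.sqrt ((periodicGroundStateEnergy v (m + 1) L).toReal /
          ((C - 1 / (4 * Real.pi ^ 2)) * L ^ 2 / ‖(fun j => (n j : ℝ))‖ ^ 2))) m L n

/-- **ChordAboveHealing** (crux of card `raman-chord-regimes`, for bounded `v`): in the density
window the chord holds with a universal constant for all source strengths above the healing
threshold `s ≥ (2π‖n‖/L) √(K ∫v)` — the regime where ONE-mode c-number substitution of the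
mode `k` (LSY 2005, error `O(ρ ∫v)`) plus completing the square `½k²|z|² − 2s|z| ≥ −2s²/k²`
plus the coherent stiffness of mode `k` (card freeze-one-mode-goldstone-gap, K1) decide the
chord; the LNSS phase operators `a₀ n̂₀^{-1/2}` stay quantum (norm ≤ 1). -/
def ChordAboveHealing : Prop :=
  ∀ v : ℝ → ℝ≥0∞, IsRepulsiveFiniteRange v → (∃ B : ℝ, ∀ r, v r ≤ ENNReal.ofReal B) →
    (∫⁻ x : Space, v ‖x‖) ≠ ⊤ →
    ∀ M : ℝ, 0 < M → ∃ ρ₀ C K : ℝ, 0 < ρ₀ ∧ 0 < C ∧ 0 < K ∧ ∃ N₀ : ℕ, ∀ m : ℕ, N₀ ≤ m + 1 →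
      ∀ L : ℝ, 0 < L → ((m + 1 : ℕ) : ℝ) ≤ ρ₀ * L ^ 3 → ∀ n : Fin 3 → ℤ, n ≠ 0 →
        2 * Real.pi * ‖(fun j => (n j : ℝ))‖ / L ≤ M * Real.sqrt ((m + 1 : ℕ) / L ^ 3) →
        GDChordFrom v C
          (2 * Real.pi * ‖(fun j => (n j : ℝ))‖ / L *
            Real.sqrt (K * ((m + 1 : ℕ) / L ^ 3) * (∫⁻ x : Space, v ‖x‖).toReal)) m L n

end Summit.AtomisticToContinuum.BoseEinsteinCondensation.Cruxes.GaussianDominationCan.Sketch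

end
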